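import Summits.Ventures.PercRepro.RankLevelSetTightLayer

/-!
# PercRepro — THE AVERAGED CONTRACTION IDENTITY, PART 2: the top level sets of all the `M ／ {e}` on the tight layer
(night-1, gen 9 session 4; paper proofs/NIGHT-1-C025-induction.md §19.12 (a); the middle half is RankLevelSetAvgMid —
the two halves are independent, both on RankLevelSetTightLayer)

On the tight layer `|E| = p + q` a member of `U_{M ／ {e}}(p − 1, q)` is `A ∖ {e}` for a unique `A ∈ U_M(p, q)` with
`e ∈ A ∖ cl(E ∖ A)`: so `Σ_{e ∈ E} #U_{M ／ {e}}(p − 1, q) = Σ_{A ∈ U_M(p,q)} |A ∖ cl(E ∖ A)|` — and `|A ∖ cl(E∖A)| = p − k_A`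
with `k_A = |cl(E∖A) ∖ (E∖A)|` the number of elements `e` for which `(A, E∖A)` is a `b″`-partition.

* `Uset_contract_eq_image` — `U_{M ／ {e}}(p−1, q) = {A ∈ U_M(p,q) : e ∈ A ∖ cl(E∖A)} ∖ {e}` (the bijection `X ↦ insert e X`);
* `Uset_contract_ncard_eq` — the counts;
* `sum_card_filter_eq_sum_ncard` — the double count `Σ_e #{i ∈ S : e ∈ f i} = Σ_{i ∈ S} |f i|`;
* `sum_topCount_contract_eq` — the identity above, as a sum over `M.E.toFinset`.

Axioms: standard.
-/
open scoped Matroid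

namespace PercRepro

open Set Finset

variable {α : Type} (M : Matroid α) [M.Finite]

/-- `U_M(p,q)` is finite. -/
lemma Uset_finite (p q : ℕ) : (Uset M p q).Finite :=
  (M.set_finite M.E).finite_subsets.subset (fun _ hA => hA.1)

/-- On the tight layer, the top sets of `M ／ {e}` at `(p − 1, q)` are the sets `A ∖ {e}` with `A ∈ U_M(p, q)`,
`e ∈ A` and `e ∉ cl(E ∖ A)`. -/
lemma Uset_contract_eq_image {e : α} (he : M.IsNonloop e) {p q : ℕ} (hp : 1 ≤ p)
    (hE : M.E.ncard = p + q) :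
    (fun X : Set α => insert e X) '' Uset (M ／ {e}) (p - 1) q =
      {A ∈ Uset M p q | e ∈ A ∧ e ∉ M.closure (M.E \ A)} := by
  have hcfin : (M ／ {e}).Finite := inferInstance
  have hE' : (M ／ {e}).E.ncard = (p - 1) + q := by
    rw [Matroid.contract_ground, ncard_sdiff_singleton_of_mem he.mem_ground, hE]
    omega
  ext A
  constructor
  · rintro ⟨X, hX, rfl⟩
    have hXg := Uset_subset_goodImg (M ／ {e}) hE' hX
    obtain ⟨hXi, hXc⟩ := hXg
    rw [mem_indImg_iff] at hXi
    obtain ⟨hXE, hXind, hXcard⟩ := hXi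
    have heX : e ∉ X := fun h => (hXE h).2 rfl
    simp only [Set.mem_setOf_eq] at hXc
    rw [he.contractElem_indep_iff] at hXind hXc
    have hXE' : X ⊆ M.E := hXE.trans (M.contract_ground_subset_ground {e})
    -- the complement of `insert e X` in `M` is the complement of `X` in `M ／ {e}`
    have hcomp : M.E \ insert e X = (M ／ {e}).E \ X := by
      rw [Matroid.contract_ground, Set.sdiff_sdiff, Set.insert_eq]
    have hcompind : M.Indep (insert e ((M ／ {e}).E \ X)) := hXc.2
    have hcompE : e ∉ (M ／ {e}).E \ X := fun h => h.1.2 rfl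
    have hcompind' : M.Indep ((M ／ {e}).E \ X) := hcompind.subset (subset_insert _ _)
    refine ⟨goodImg_subset_Uset M hE ⟨?_, ?_⟩, mem_insert e X, ?_⟩
    · rw [mem_indImg_iff]
      refine ⟨insert_subset he.mem_ground hXE', hXind.2, ?_⟩
      rw [encard_insert_of_notMem heX, hXcard, ← Nat.cast_add_one, Nat.sub_add_cancel hp]
    · simp only [Set.mem_setOf_eq]
      rw [hcomp]
      exact hcompind'
    · rw [hcomp]
      exact fun hcl => ((hcompind'.insert_indep_iff_of_notMem hcompE).1 hcompind).2 hcl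
  · rintro ⟨hA, heA, hecl⟩
    have hAg := Uset_subset_goodImg M hE hA
    obtain ⟨hAi, hAc⟩ := hAg
    rw [mem_indImg_iff] at hAi
    obtain ⟨hAE, hAind, hAcard⟩ := hAi
    simp only [Set.mem_setOf_eq] at hAc
    refine ⟨A \ {e}, ?_, ?_⟩
    · refine goodImg_subset_Uset (M ／ {e}) hE' ⟨?_, ?_⟩
      · rw [mem_indImg_iff]
        refine ⟨?_, ?_, ?_⟩
        · rw [Matroid.contract_ground]
          exact sdiff_subset_sdiff_left hAE
        · rw [he.contractElem_indep_iff]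
          refine ⟨fun h => h.2 rfl, ?_⟩
          rwa [insert_sdiff_singleton, insert_eq_of_mem heA]
        · rw [encard_sdiff_singleton_of_mem heA, hAcard]
          rfl
      · simp only [Set.mem_setOf_eq]
        have hcomp : (M ／ {e}).E \ (A \ {e}) = M.E \ A := by
          rw [Matroid.contract_ground]
          ext x
          simp only [Set.mem_sdiff, Set.mem_singleton_iff]
          constructor
          · rintro ⟨⟨hxE, hxe⟩, hx⟩
            exact ⟨hxE, fun hxA => hx ⟨hxA, hxe⟩⟩
          · rintro ⟨hxE, hxA⟩
            exact ⟨⟨hxE, fun h => hxA (h ▸ heA)⟩, fun h => hxA h.1⟩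
        rw [hcomp, he.contractElem_indep_iff]
        refine ⟨fun h => h.2 heA, ?_⟩
        have heE : e ∉ M.E \ A := fun h => h.2 heA
        exact (hAc.insert_indep_iff_of_notMem heE).2 ⟨he.mem_ground, hecl⟩
    · exact insert_sdiff_singleton.trans (insert_eq_of_mem heA)

/-- `#U_{M ／ {e}}(p − 1, q) = #{A ∈ U_M(p, q) : e ∈ A ∖ cl(E ∖ A)}` on the tight layer. -/
lemma Uset_contract_ncard_eq {e : α} (he : M.IsNonloop e) {p q : ℕ} (hp : 1 ≤ p)
    (hE : M.E.ncard = p + q) :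
    (Uset (M ／ {e}) (p - 1) q).ncard = {A ∈ Uset M p q | e ∈ A ∧ e ∉ M.closure (M.E \ A)}.ncard := by
  rw [← Uset_contract_eq_image M he hp hE]
  refine (Set.InjOn.ncard_image ?_).symm
  rintro X ⟨hXE, -, -⟩ X' ⟨hX'E, -, -⟩ hEq
  have heX : e ∉ X := fun h => (hXE h).2 rfl
  have heX' : e ∉ X' := fun h => (hX'E h).2 rfl
  have h1 : insert e X \ {e} = insert e X' \ {e} := by
    simp only at hEq
    rw [hEq]
  rwa [insert_sdiff_self_of_notMem heX, insert_sdiff_self_of_notMem heX'] at h1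

open scoped Classical in
/-- The double count with a set-valued map: `Σ_{e ∈ E} #{i ∈ S : e ∈ f i} = Σ_{i ∈ S} |f i|` when every `f i ⊆ E`. -/
lemma sum_card_filter_eq_sum_ncard {β ι : Type} (E : Finset β) (S : Finset ι) (f : ι → Set β)
    (hS : ∀ i ∈ S, f i ⊆ (E : Set β)) :
    ∑ e ∈ E, (S.filter (fun i => e ∈ f i)).card = ∑ i ∈ S, (f i).ncard := by
  calc ∑ e ∈ E, (S.filter (fun i => e ∈ f i)).card
      = ∑ e ∈ E, ∑ i ∈ S, (if e ∈ f i then 1 else 0) := by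
        refine Finset.sum_congr rfl (fun e _ => ?_)
        rw [Finset.card_filter]
    _ = ∑ i ∈ S, ∑ e ∈ E, (if e ∈ f i then 1 else 0) := Finset.sum_comm
    _ = ∑ i ∈ S, (f i).ncard := by
        refine Finset.sum_congr rfl (fun i hi => ?_)
        rw [← Finset.card_filter]
        have hT' : f i = ((E.filter (fun x => x ∈ f i) : Finset β) : Set β) := by
          ext x
          simp only [Finset.coe_filter, Set.mem_setOf_eq]
          exact ⟨fun hx => ⟨hS i hi hx, hx⟩, fun hx => hx.2⟩
        conv_rhs => rw [hT']
        rw [Set.ncard_coe_finset]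

open scoped Classical in
/-- For `e ∈ E` the top count of `M ／ {e}` is the number of members `A` of `U_M(p,q)` with `e ∈ A ∖ cl(E∖A)`. -/
lemma topCount_contract_eq_card_filter {e : α} (he : M.IsNonloop e) {p q : ℕ} (hp : 1 ≤ p)
    (hE : M.E.ncard = p + q) :
    Matroid.topCount (M ／ {e}) (p - 1) q =
      ((Uset_finite M p q).toFinset.filter (fun A => e ∈ A \ M.closure (M.E \ A))).card := by
  have : (M ／ {e}).Finite := inferInstance
  rw [topCount_eq_ncard_Uset, Uset_contract_ncard_eq M he hp hE]
  have hset : {A ∈ Uset M p q | e ∈ A ∧ e ∉ M.closure (M.E \ A)} =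
      (((Uset_finite M p q).toFinset.filter (fun A => e ∈ A \ M.closure (M.E \ A)) :
        Finset (Set α)) : Set (Set α)) := by
    ext A
    simp only [Set.mem_setOf_eq, Finset.coe_filter, Set.Finite.mem_toFinset, mem_sdiff]
  rw [hset, Set.ncard_coe_finset]

open scoped Classical in
/-- **THE TOP HALF OF THE AVERAGED IDENTITY** on the tight layer `|E| = p + q`: if every element is a non-loop,
`Σ_{e ∈ E} #U_{M ／ {e}}(p − 1, q) = Σ_{A ∈ U_M(p, q)} |A ∖ cl(E ∖ A)|`. -/
theorem sum_topCount_contract_eq (hl : ∀ e ∈ M.E, M.IsNonloop e) {p q : ℕ} (hp : 1 ≤ p)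
    (hE : M.E.ncard = p + q) :
    ∑ e ∈ (M.set_finite M.E).toFinset, Matroid.topCount (M ／ {e}) (p - 1) q =
      ∑ A ∈ (Uset_finite M p q).toFinset, (A \ M.closure (M.E \ A)).ncard := by
  calc ∑ e ∈ (M.set_finite M.E).toFinset, Matroid.topCount (M ／ {e}) (p - 1) q
      = ∑ e ∈ (M.set_finite M.E).toFinset,
          ((Uset_finite M p q).toFinset.filter
            (fun A => e ∈ (fun B : Set α => B \ M.closure (M.E \ B)) A)).card := by
        refine Finset.sum_congr rfl (fun e he => ?_)
        rw [Set.Finite.mem_toFinset] at he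
        rw [topCount_contract_eq_card_filter M (hl e he) hp hE]
    _ = ∑ A ∈ (Uset_finite M p q).toFinset, (A \ M.closure (M.E \ A)).ncard := by
        have key := sum_card_filter_eq_sum_ncard (M.set_finite M.E).toFinset (Uset_finite M p q).toFinset
          (fun B : Set α => B \ M.closure (M.E \ B))
          (fun A hA => by
            rw [Set.Finite.mem_toFinset] at hA
            rw [Set.Finite.coe_toFinset]
            exact sdiff_subset.trans hA.1)
        convert key using 4

end PercRepro
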